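import Literature.AlgebraicGeometry.HodgeTheory.HyperplaneSectionLocalSystem
import Literature.AlgebraicGeometry.HodgeTheory.LocallyTrivialExtensionClasses
import Summits.HodgeConjecture.HodgeConjecture.Theorems.LinearSystemTorelliLocalTubeSpanTrivialSummand

/-!
# Route LinearSystemTorelli — crux `LocalTubeSpan` (stmt-HodgeConjecture-2490): vanishing versus full carrier

Helper file (`--supports stmt-HodgeConjecture-2490`, line `Sketch` of the crux chain, cycle 5
"assembly on the tree's objects", stub `stub_vanishingTransfer`).  The line reduces the crux (the
"local Schnell theorem", C. Schnell, *Primitive cohomology and the tube mapping*, Math. Z. 268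
(2010) §3, §7) to CYCLIC DETECTION: injectivity of Schnell's third map
`evalCoinv A : H¹(G, A) → ∏_{g ∈ G} A/(g - 1)A` for the monodromy representation restricted to
a local fundamental group.  The typed candidates of the crux are stated on the VANISHING sub-local
system `D.vanishingLocalSystem μ hX hb ⊆ D.V n` of a hyperplane-section family
(`Literature.AlgebraicGeometry.HodgeTheory.HyperplaneSectionLocalSystem`), whereas the `ℚ`-form is
natural on the full `Rⁿ π_* ℂ|_U = D.V n`; this file moves cyclic detection between the two:

* `localTubeSpan_vanishingTransfer` — given the Lefschetz splitting
  `Hⁿ(X_s(ℂ); ℂ) = Hⁿ(X_s)_van ⊕ (ι_s ≫ j)^* Hⁿ(X(ℂ); ℂ)` at the base point `s` (hypothesis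
  `IsCompl`, Voisin II Prop. 2.27 for hypersurface sections), for every subgroup `S ≤ π₁(U, s)`
  Schnell's third map of `(monodromyRepObj (D.vanishingLocalSystem μ hX hb) s)|_S` is injective
  iff that of `(monodromyRepObj (D.V n) s)|_S` is.

Proof: transport the splitting through the stalk identification
`D.fiberIso n s : (V n)_s ≃ Hⁿ(X_s)` (`Submodule.orderIsoMapComap`); the first summand
`fiberIso⁻¹(Hⁿ(X_s)_van)` is monodromy-stable
(`HyperplaneSectionLocalSystem.transportBetti_mem_vanishing`), the second is monodromy-TRIVIAL
(restricted ambient classes are invariant, `DirectImageLocalSystem.transportBetti_map_comp`), so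
`localTubeSpan_injective_evalCoinv_iff_of_trivialComplement` (`…TrivialSummand`) identifies
detection for the full carrier with detection for the subrepresentation on the first summand —
which is DEFINITIONALLY the restricted monodromy representation of the sub-local system
(`Motives.LocalSystem.subsystem`: same carrier `↥(fiberIso⁻¹(Hⁿ(X_s)_van))`, transport = the
restricted transport).  Pure bookkeeping over the tree's `HyperplaneSectionLocalSystem` /
`LocallyTrivialExtensionClasses` and Mathlib; no named facts.
-/

-- `Summit.HodgeConjecture.HodgeConjecture.Theorems` is the mandated namespace (single-conjunct
-- summit: Sub = Summit), which `linter.dupNamespace` flags on every declaration; the lakefile turns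
-- the linter off tree-wide (weak option), restated here so stand-alone elaboration is warning-free.
set_option linter.dupNamespace false

noncomputable section

open CategoryTheory groupCohomology
open Literature.AlgebraicGeometry Literature.AlgebraicGeometry.HodgeTheory
open Literature.AlgebraicTopology.SingularHomology

namespace Summit.HodgeConjecture.HodgeConjecture.Theorems

variable {𝒳 Sb : Motives.SchemeOver ℂ} {π : 𝒳 ⟶ Sb} {n : ℕ}

/-- **Vanishing versus full carrier.**  Let `D` be a hyperplane-section local system of the family
`π : 𝒳 ⟶ Sb` of `n`-dimensional members of `X` (`j : 𝒳 ⟶ X`), `s ∈ U` a base point and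
`S ≤ π₁(U, s)` any subgroup (a local fundamental group).  Given the Lefschetz splitting
`Hⁿ(X_s(ℂ); ℂ) = Hⁿ(X_s)_van ⊕ (ι_s ≫ j)^* Hⁿ(X(ℂ); ℂ)`, Schnell's third map
`H¹(S, A) → ∏_{g ∈ S} A/(g - 1)A` is injective for `A =` the stalk of the vanishing sub-local
system `(Rⁿ π_* ℂ)_van` iff it is injective for `A =` the stalk of the full `Rⁿ π_* ℂ`: the
complement `(ι_s ≫ j)^* Hⁿ(X)` is monodromy-trivial, and the monodromy of the sub-local system is
the subrepresentation of the full monodromy on `fiberIso⁻¹(Hⁿ(X_s)_van)`. [folklore] -/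
theorem localTubeSpan_vanishingTransfer {X : Motives.SchemeOver ℂ} {j : 𝒳 ⟶ X}
    (D : HyperplaneSectionLocalSystem π n j) (μ : OrientationFamily) {m b : ℕ}
    (hX : Motives.IsSmoothProjective m X) (hb : n + 2 * m = b + 2 * n) (s : smoothFiberLocus π n)
    (hcompl : IsCompl (vanishing π n j μ hX hb s)
      (LinearMap.range (complexBetti.map (Motives.fiberι π s.1 ≫ j) n).hom))
    (S : Subgroup (FundamentalGroup (smoothFiberLocus π n) s)) :
    Function.Injective
        (evalCoinv (Rep.res S.subtype (monodromyRepObj (D.vanishingLocalSystem μ hX hb) s))) ↔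
      Function.Injective (evalCoinv (Rep.res S.subtype (monodromyRepObj (D.V n) s))) := by
  -- the full carrier `(V n)_s` restricted to `S`, and the two summands pulled back along `fiberIso`
  set A : Rep ℂ S := Rep.res S.subtype (monodromyRepObj (D.V n) s)
  let W₁ : Submodule ℂ A.V := (vanishing π n j μ hX hb s).comap (D.fiberIso n s).toLinearMap
  let W₂ : Submodule ℂ A.V :=
    (LinearMap.range (complexBetti.map (Motives.fiberι π s.1 ≫ j) n).hom).comap
      (D.fiberIso n s).toLinearMap
  -- `S` acts through parallel transport along its loops
  have hρ : ∀ (g : S) (x : A.V), A.ρ g x =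
      (D.V n).transport
        (FundamentalGroup.toPath (g : FundamentalGroup (smoothFiberLocus π n) s)) x :=
    fun g x => rfl
  -- the vanishing summand is stable
  have h₁ : ∀ g : S, W₁ ≤ W₁.comap (A.ρ g) := by
    intro g x hx
    simp only [Submodule.mem_comap, LinearEquiv.coe_coe, W₁] at hx ⊢
    rw [hρ]
    simpa [DirectImageLocalSystem.transportBetti_apply] using D.transportBetti_mem_vanishing μ hX hb
      (FundamentalGroup.toPath (g : FundamentalGroup (smoothFiberLocus π n) s)) hx
  -- the ambient summand is fixed pointwise
  have h₂ : ∀ g : S, ∀ w ∈ W₂, A.ρ g w = w := by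
    intro g w hw
    simp only [Submodule.mem_comap, LinearEquiv.coe_coe, W₂, LinearMap.mem_range] at hw
    obtain ⟨y, hy⟩ := hw
    rw [hρ]
    apply (D.fiberIso n s).injective
    have key : D.transportBetti n
        (FundamentalGroup.toPath (g : FundamentalGroup (smoothFiberLocus π n) s))
          (D.fiberIso n s w) = D.fiberIso n s w := by
      rw [← hy]
      exact D.transportBetti_map_comp j n _ y
    rwa [DirectImageLocalSystem.transportBetti_apply, LinearEquiv.symm_apply_apply] at key
  -- the splitting, transported through the stalk identification
  have hc : IsCompl W₁ W₂ := (Submodule.orderIsoMapComap (D.fiberIso n s)).symm.isCompl hcompl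
  -- detection for `A` ⇔ detection for the subrepresentation on `W₁`, which is definitionally
  -- the restricted monodromy representation of the vanishing sub-local system
  exact (localTubeSpan_injective_evalCoinv_iff_of_trivialComplement A W₁ W₂ h₁ h₂ hc).symm

end Summit.HodgeConjecture.HodgeConjecture.Theorems

end
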